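import Summits.QuantumFields.QCD.Theses.NestedDissectionSea
import Summits.QuantumFields.QCD.Theorems.CoerciveSea.Negative.CellDeterminants

/-!
# Crux `CoerciveSea` (stmt-QuantumFields-13901), line `chirality-collapses-pseudospectrum` —
# stub 1: the PILE-UP LEMMA (`stub_sheetPileupOfSingularSeparator`)

A `τ`-singular Schur separator of a Dirichlet Wilson cell (`HasSingularSeparator U μ s τ`: a vector
`w` on the corner-`0` box, harmonic on the children interiors, not identically zero on the internal
separator `Σ`, with separator residual `< τ ×` its separator mass) forces the HERMITIAN cell
operator `H = Γ_c D_c` (`Γ_c` = diagonal of chirality signs `γ₅_{αα} = ±1`; hermiticity is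
entrywise `γ₅`-hermiticity `conj D_{ji} = χ_i D_{ij} χ_j`, landed as
`CoerciveSeaNegative.conj_wilsonDirac_apply`) to PILE SHEET WEIGHT of its low modes: there is an
orthonormal eigenfamily `(u_j, λ_j)`, `D_c u_j = λ_j Γ_c u_j`, `|λ_j| < 2τ`, with weights
`0 ≤ w_j`, `w_j |λ_j| ≤ 1`, whose sheet-weighted pile-up `Σ_j w_j f(u_j)` exceeds `1/(2τ)`
(`f(u) = Σ_{p ∈ Σ} ‖u_p‖²`). Exact finite-dimensional linear algebra: spectral theorem for `H`
(`Matrix.IsHermitian.eigenvectorBasis`), resolvent split at `2τ` (Bessel on the high part,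
Cauchy–Schwarz on the separator-supported residual for the low part), exact zero modes carrying
sheet weight handled by a large weight. [folklore]
-/

noncomputable section

open scoped BigOperators InnerProductSpace
open Matrix WithLp

namespace Summit.QuantumFields.QCD.Cruxes.CoerciveSea.ChiralityCollapsesPseudospectrum

/-! ### Generic linear algebra on `EuclideanSpace ℂ ι` with a sheet projection `P` -/

section Generic

variable {ι : Type*} [Fintype ι] {I : ι → Prop} [DecidablePred I]
  {P : EuclideanSpace ℂ ι →ₗ[ℂ] EuclideanSpace ℂ ι}

/-- `‖P x‖² = Σ_{p ∉ I} ‖x_p‖²` for a sheet projection `P` (kill the components in the children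
interior `I`): the sheet fraction of a unit vector. [folklore] -/
theorem norm_proj_sq (hP : ∀ x p, P x p = if I p then 0 else x p) (x : EuclideanSpace ℂ ι) :
    ‖P x‖ ^ 2 = ∑ p, if I p then (0 : ℝ) else ‖x p‖ ^ 2 := by
  rw [EuclideanSpace.norm_sq_eq]
  refine Finset.sum_congr rfl fun p _ => ?_
  rw [hP]
  split_ifs <;> simp

/-- A sheet projection is a contraction. [folklore] -/
theorem norm_proj_le (hP : ∀ x p, P x p = if I p then 0 else x p) (x : EuclideanSpace ℂ ι) :
    ‖P x‖ ≤ ‖x‖ := by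
  refine le_of_pow_le_pow_left₀ two_ne_zero (norm_nonneg _) ?_
  rw [norm_proj_sq hP, EuclideanSpace.norm_sq_eq]
  exact Finset.sum_le_sum fun p _ => by split_ifs <;> first | positivity | exact le_rfl

/-- Pairing with a separator-supported vector only sees the sheet projection. [folklore] -/
theorem inner_eq_inner_proj (hP : ∀ x p, P x p = if I p then 0 else x p) (x y : EuclideanSpace ℂ ι)
    (hy : ∀ p, I p → y p = 0) : ⟪x, y⟫_ℂ = ⟪P x, y⟫_ℂ := by
  simp only [EuclideanSpace.inner_eq_star_dotProduct, dotProduct, Pi.star_apply]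
  refine Finset.sum_congr rfl fun p _ => ?_
  change y p * star (x p) = y p * star (P x p)
  rw [hP]
  split_ifs with hp
  · rw [hy p hp, zero_mul, zero_mul]
  · rfl

/-- **Pile-up lemma, spectral core.** For an orthonormal basis `b` with real labels `λ_j`, a vector
`w` and a separator-supported `g` with `λ_j ⟪b_j, w⟫ = ⟪b_j, g⟫` (the eigen-pairing of a Hermitian
operator, `g = H w`) and `‖g‖ < τ ‖P_Σ w‖`: the sheet-weighted pile-up of the modes below `2τ`
exceeds `1/(2τ)` (weights `1/|λ_j|`, and `1/(τ Z)` on exact zero modes, `Z` their total sheet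
weight). Resolvent split at `2τ`: Bessel bounds the high part by `‖g‖/(2τ) < ‖P_Σ w‖/2`,
Cauchy–Schwarz against the separator-supported `g` bounds the low part. [folklore] -/
theorem pileup_core (hP : ∀ x p, P x p = if I p then 0 else x p)
    (b : OrthonormalBasis ι ℂ (EuclideanSpace ℂ ι)) (lam : ι → ℝ) (w g : EuclideanSpace ℂ ι)
    {τ : ℝ} (hτ : 0 < τ) (hkey : ∀ j, ((lam j : ℝ) : ℂ) * ⟪b j, w⟫_ℂ = ⟪b j, g⟫_ℂ)
    (hg : ∀ p, I p → g p = 0) (hgw : ‖g‖ < τ * ‖P w‖) (wgt : ι → ℝ)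
    (hwgt : ∀ j, wgt j = if lam j = 0
      then 1 / (τ * ∑ i, if lam i = 0 then ‖P (b i)‖ ^ 2 else 0) else 1 / |lam j|) :
    1 / (2 * τ) < ∑ j, if |lam j| < 2 * τ then wgt j * ‖P (b j)‖ ^ 2 else 0 := by
  generalize hZ : (∑ i, if lam i = 0 then ‖P (b i)‖ ^ 2 else 0) = Z at hwgt
  obtain ⟨S, hS⟩ : ∃ S : ℝ, S = ∑ j, if |lam j| < 2 * τ then wgt j * ‖P (b j)‖ ^ 2 else 0 :=
    ⟨_, rfl⟩
  rw [← hS]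
  have hZnn : 0 ≤ Z := hZ ▸ Finset.sum_nonneg fun i _ => by split_ifs <;> positivity
  have hwgt_nn : ∀ j, 0 ≤ wgt j := fun j => by rw [hwgt j]; split_ifs <;> positivity
  have hSnn : 0 ≤ S := hS ▸ Finset.sum_nonneg fun j _ => by
    split_ifs <;> first | exact mul_nonneg (hwgt_nn j) (sq_nonneg _) | exact le_rfl
  have hWpos : 0 < ‖P w‖ := by
    by_contra hle
    rw [le_antisymm (not_lt.mp hle) (norm_nonneg _), mul_zero] at hgw
    exact absurd hgw (not_lt.mpr (norm_nonneg _))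
  by_cases hZ0 : Z = 0
  · -- CASE A: every exact zero mode carries no sheet weight
    have hF0 : ∀ j, lam j = 0 → ‖P (b j)‖ = 0 := by
      intro j hj
      have hle : ‖P (b j)‖ ^ 2 ≤ Z := by
        rw [← hZ]
        have h := Finset.single_le_sum
          (f := fun i => if lam i = 0 then ‖P (b i)‖ ^ 2 else 0)
          (fun i _ => by split_ifs <;> positivity) (Finset.mem_univ j)
        simpa only [if_pos hj] using h
      rw [hZ0] at hle
      exact pow_eq_zero_iff two_ne_zero |>.mp (le_antisymm hle (sq_nonneg _))
    -- coefficients and the Cauchy–Schwarz bound `|λ_j| ‖c_j‖ ≤ ‖P b_j‖ ‖g‖`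
    obtain ⟨c, hc⟩ : ∃ c : ι → ℂ, c = fun j => ⟪b j, w⟫_ℂ := ⟨_, rfl⟩
    have hcj : ∀ j, ⟪b j, w⟫_ℂ = c j := fun j => by rw [hc]
    have hcs : ∀ j, |lam j| * ‖c j‖ ≤ ‖P (b j)‖ * ‖g‖ := by
      intro j
      have h1 : ‖((lam j : ℝ) : ℂ) * c j‖ = ‖⟪b j, g⟫_ℂ‖ := by rw [← hcj, hkey]
      rw [norm_mul, Complex.norm_real, Real.norm_eq_abs] at h1
      rw [h1, inner_eq_inner_proj hP (b j) g hg]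
      exact norm_inner_le_norm _ _
    -- resolvent split at `2τ`
    obtain ⟨chi, hchi⟩ : ∃ f : ι → ℂ, f = fun j => if 2 * τ ≤ |lam j| then c j else 0 := ⟨_, rfl⟩
    obtain ⟨clo, hclo⟩ : ∃ f : ι → ℂ, f = fun j => if 2 * τ ≤ |lam j| then 0 else c j := ⟨_, rfl⟩
    obtain ⟨hi, hhi⟩ : ∃ hi : EuclideanSpace ℂ ι, hi = ∑ j, chi j • b j := ⟨_, rfl⟩
    obtain ⟨lo, hlo⟩ : ∃ lo : EuclideanSpace ℂ ι, lo = ∑ j, clo j • b j := ⟨_, rfl⟩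
    have hsum : hi + lo = w := by
      rw [hhi, hlo, ← Finset.sum_add_distrib]
      conv_rhs => rw [← b.sum_repr' w]
      refine Finset.sum_congr rfl fun j _ => ?_
      rw [← add_smul, hcj, hchi, hclo]
      congr 1
      dsimp only
      split_ifs <;> simp
    -- HIGH part: Bessel, `‖hi‖ ≤ ‖g‖ / (2τ)`
    have hhigh : ‖hi‖ ≤ ‖g‖ / (2 * τ) := by
      refine le_of_pow_le_pow_left₀ two_ne_zero (by positivity) ?_
      rw [← b.sum_sq_norm_inner_right hi, div_pow, ← b.sum_sq_norm_inner_right g,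
        Finset.sum_div]
      refine Finset.sum_le_sum fun j _ => ?_
      rw [hhi, b.orthonormal.inner_right_fintype, hchi]
      dsimp only
      split_ifs with hj
      · rw [le_div_iff₀ (by positivity), ← mul_pow]
        refine pow_le_pow_left₀ (by positivity) ?_ 2
        rw [← hkey, hcj, norm_mul, Complex.norm_real, Real.norm_eq_abs]
        calc ‖c j‖ * (2 * τ) = (2 * τ) * ‖c j‖ := mul_comm _ _
          _ ≤ |lam j| * ‖c j‖ := mul_le_mul_of_nonneg_right hj (norm_nonneg _)
      · rw [norm_zero, sq, zero_mul]; positivity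
    -- LOW part: triangle inequality, `‖P lo‖ ≤ Σ ‖clo_j‖ ‖P b_j‖ ≤ ‖g‖ S`
    have hlow : ‖P lo‖ ≤ ‖g‖ * S := by
      rw [hlo, map_sum, hS, Finset.mul_sum]
      refine (norm_sum_le _ _).trans (Finset.sum_le_sum fun j _ => ?_)
      rw [map_smul, norm_smul, hclo]
      dsimp only
      by_cases hj : 2 * τ ≤ |lam j|
      · rw [if_pos hj, if_neg (not_lt.mpr hj), norm_zero, zero_mul, mul_zero]
      · rw [if_neg hj, if_pos (not_le.mp hj)]
        by_cases h0 : lam j = 0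
        · rw [hF0 j h0, mul_zero, sq, mul_zero, mul_zero, mul_zero]
        · rw [hwgt j, if_neg h0]
          have hpos : 0 < |lam j| := abs_pos.mpr h0
          rw [one_div, ← div_eq_inv_mul, mul_div_assoc', le_div_iff₀ hpos]
          calc ‖c j‖ * ‖P (b j)‖ * |lam j|
              = (|lam j| * ‖c j‖) * ‖P (b j)‖ := by ring
            _ ≤ (‖P (b j)‖ * ‖g‖) * ‖P (b j)‖ :=
                mul_le_mul_of_nonneg_right (hcs j) (norm_nonneg _)
            _ = ‖g‖ * ‖P (b j)‖ ^ 2 := by ring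
    -- assemble: `‖P w‖ ≤ ‖g‖ (1/(2τ) + S) < τ ‖P w‖ (1/(2τ) + S)`
    have hW : ‖P w‖ ≤ ‖g‖ * (1 / (2 * τ) + S) := by
      rw [← hsum, map_add, mul_add, mul_one_div]
      exact (norm_add_le _ _).trans (add_le_add ((norm_proj_le hP hi).trans hhigh) hlow)
    have hpos : 0 < 1 / (2 * τ) + S := add_pos_of_pos_of_nonneg (by positivity) hSnn
    have h1 : ‖P w‖ < ‖P w‖ * (τ * (1 / (2 * τ) + S)) :=
      calc ‖P w‖ ≤ ‖g‖ * (1 / (2 * τ) + S) := hW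
        _ < τ * ‖P w‖ * (1 / (2 * τ) + S) := mul_lt_mul_of_pos_right hgw hpos
        _ = ‖P w‖ * (τ * (1 / (2 * τ) + S)) := by ring
    have h2 : 1 < τ * (1 / (2 * τ) + S) := (lt_mul_iff_one_lt_right hWpos).mp h1
    have h3 : τ * (1 / (2 * τ) + S) = 1 / 2 + τ * S := by
      rw [mul_add, mul_one_div, mul_comm 2 τ, ← div_div, div_self hτ.ne']
    rw [h3] at h2
    rw [div_lt_iff₀ (by positivity)]
    nlinarith
  · -- CASE B: an exact zero mode carries sheet weight; its weight `1/(τ Z)` alone piles `1/τ`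
    have hZpos : 0 < Z := lt_of_le_of_ne hZnn (Ne.symm hZ0)
    have hle : ∑ j, (if lam j = 0 then 1 / (τ * Z) * ‖P (b j)‖ ^ 2 else 0) ≤ S := by
      rw [hS]
      refine Finset.sum_le_sum fun j _ => ?_
      by_cases h0 : lam j = 0
      · have hlt : |lam j| < 2 * τ := by rw [h0, abs_zero]; positivity
        rw [if_pos h0, if_pos hlt, hwgt j, if_pos h0]
      · rw [if_neg h0]
        split_ifs <;> first | exact mul_nonneg (hwgt_nn j) (sq_nonneg _) | exact le_rfl
    have hsumZ : ∑ j, (if lam j = 0 then 1 / (τ * Z) * ‖P (b j)‖ ^ 2 else 0) = 1 / τ :=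
      calc ∑ j, (if lam j = 0 then 1 / (τ * Z) * ‖P (b j)‖ ^ 2 else 0)
          = 1 / (τ * Z) * ∑ j, (if lam j = 0 then ‖P (b j)‖ ^ 2 else 0) := by
            rw [Finset.mul_sum]
            exact Finset.sum_congr rfl fun j _ => by split_ifs <;> simp
        _ = 1 / (τ * Z) * Z := by rw [hZ]
        _ = 1 / τ := by field_simp
    calc 1 / (2 * τ) < 1 / τ := by rw [div_lt_div_iff_of_pos_left one_pos (by positivity) hτ]; linarith
      _ = _ := hsumZ.symm
      _ ≤ S := hle

/-- `Σ_p conj(x_p) y_p` is the `EuclideanSpace` inner product. [folklore] -/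
theorem sum_star_mul_eq_inner (x y : EuclideanSpace ℂ ι) :
    ∑ p, star (x p) * y p = ⟪x, y⟫_ℂ := by
  rw [EuclideanSpace.inner_eq_star_dotProduct, dotProduct]
  exact Finset.sum_congr rfl fun p _ => mul_comm _ _

/-- **Pile-up lemma, matrix form.** For a `χ`-Hermitian matrix `D` (`conj D_{ji} = χ_i D_{ij} χ_j`,
`χ_p = ±1` real: entrywise `γ₅`-hermiticity), a children-interior predicate `I`, and a vector `w`
harmonic on `I` with separator residual `Σ_{p ∉ I} ‖(D w)_p‖² < τ² Σ_{p ∉ I} ‖w_p‖²` (`τ > 0`; the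
strict inequality forces `w ≠ 0` on the separator `¬ I`): there is an orthonormal family of
eigenvectors `D u_j = ev_j χ u_j` of the Hermitian matrix `diag(χ) D` with `|ev_j| < 2τ` and weights
`0 ≤ wgt_j`, `wgt_j |ev_j| ≤ 1`, whose sheet-weighted pile-up `Σ_j wgt_j Σ_{p ∉ I} ‖u_j p‖²`
exceeds `1/(2τ)` — the spectral theorem (`Matrix.IsHermitian.eigenvectorBasis`) feeds
`pileup_core`; the family is the set of all modes below `2τ`, re-indexed by `Fin n`. [folklore] -/
theorem pileup_of_chiHermitian [DecidableEq ι] (D : Matrix ι ι ℂ) (χ : ι → ℂ)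
    (hχ2 : ∀ p, χ p * χ p = 1) (hχs : ∀ p, star (χ p) = χ p)
    (hD : ∀ i j, star (D j i) = χ i * D i j * χ j) (I : ι → Prop) [DecidablePred I]
    (w : ι → ℂ) (hharm : ∀ p, I p → (D *ᵥ w) p = 0) {τ : ℝ}
    (hres : ∑ p, (if I p then (0 : ℝ) else ‖(D *ᵥ w) p‖ ^ 2) <
      τ ^ 2 * ∑ p, (if I p then (0 : ℝ) else ‖w p‖ ^ 2))
    (hτ : 0 < τ) :
    ∃ n : ℕ, ∃ u : Fin n → (ι → ℂ), ∃ ev wgt : Fin n → ℝ,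
      (∀ i j, ∑ p, star (u i p) * u j p = if i = j then 1 else 0) ∧
      (∀ j, D.mulVec (u j) = fun p => (ev j : ℂ) * χ p * u j p) ∧
      (∀ j, |ev j| < 2 * τ ∧ 0 ≤ wgt j ∧ wgt j * |ev j| ≤ 1) ∧
      1 / (2 * τ) < ∑ j, wgt j * ∑ p, if I p then (0 : ℝ) else ‖u j p‖ ^ 2 := by
  -- the Hermitian cell operator `H = Γ D`, `Γ = diag χ`
  obtain ⟨H, hH_def⟩ : ∃ H : Matrix ι ι ℂ, H = diagonal χ * D := ⟨_, rfl⟩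
  have hH : H.IsHermitian := by
    refine Matrix.IsHermitian.ext fun i j => ?_
    rw [hH_def, diagonal_mul, diagonal_mul, star_mul', hD, hχs]
    linear_combination (χ i * D i j) * hχ2 j
  -- spectral theorem: an orthonormal eigenbasis with real eigenvalues
  obtain ⟨b, lam, hbl⟩ : ∃ (b : OrthonormalBasis ι ℂ (EuclideanSpace ℂ ι)) (lam : ι → ℝ),
      ∀ j, H *ᵥ ⇑(b j) = lam j • ⇑(b j) :=
    ⟨hH.eigenvectorBasis, hH.eigenvalues, hH.mulVec_eigenvectorBasis⟩
  -- `|χ| = 1`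
  have hχnorm : ∀ p, ‖χ p‖ = 1 := fun p => by
    have h : ‖χ p‖ ^ 2 = 1 := by rw [sq, ← norm_mul, hχ2, norm_one]
    exact (pow_eq_one_iff_of_nonneg (norm_nonneg _) two_ne_zero).mp h
  -- eigen-relation for `D`: `D u = λ Γ u`
  have heig : ∀ j, D *ᵥ ⇑(b j) = fun p => ((lam j : ℝ) : ℂ) * χ p * b j p := by
    intro j
    funext p
    have hp := congrFun (hbl j) p
    rw [hH_def, ← mulVec_mulVec, mulVec_diagonal, Pi.smul_apply, Complex.real_smul] at hp
    calc (D *ᵥ ⇑(b j)) p = χ p * (χ p * (D *ᵥ ⇑(b j)) p) := by rw [← mul_assoc, hχ2, one_mul]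
      _ = χ p * ((lam j : ℂ) * b j p) := by rw [hp]
      _ = (lam j : ℂ) * χ p * b j p := by ring
  -- the vectors `w` and `g = H w = Γ (D w)` in `EuclideanSpace`
  set wE : EuclideanSpace ℂ ι := toLp 2 w with hwE
  set g : EuclideanSpace ℂ ι := toLp 2 (H *ᵥ w) with hg_def
  have hg : ∀ p, I p → g p = 0 := by
    intro p hp
    show (H *ᵥ w) p = 0
    rw [hH_def, ← mulVec_mulVec, mulVec_diagonal, hharm p hp, mul_zero]
  -- `λ_j ⟪b_j, w⟫ = ⟪H b_j, w⟫ = ⟪b_j, H w⟫`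
  have hkey : ∀ j, ((lam j : ℝ) : ℂ) * ⟪b j, wE⟫_ℂ = ⟪b j, g⟫_ℂ := by
    intro j
    have hvH : star ⇑(b j) ᵥ* H = lam j • star ⇑(b j) := by
      have h := congrArg star (hbl j)
      rwa [star_mulVec, hH.eq, star_smul, star_trivial (lam j)] at h
    rw [EuclideanSpace.inner_eq_star_dotProduct, EuclideanSpace.inner_eq_star_dotProduct]
    change ((lam j : ℝ) : ℂ) * (w ⬝ᵥ star ⇑(b j)) = (H *ᵥ w) ⬝ᵥ star ⇑(b j)
    rw [dotProduct_comm (H *ᵥ w), dotProduct_mulVec, hvH, smul_dotProduct, dotProduct_comm,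
      Complex.real_smul]
  -- the sheet projection `P` (kill the children-interior components)
  obtain ⟨P, hP⟩ : ∃ P : EuclideanSpace ℂ ι →ₗ[ℂ] EuclideanSpace ℂ ι,
      ∀ x p, P x p = if I p then 0 else x p :=
    ⟨{ toFun := fun x => toLp 2 fun p => if I p then 0 else x p
       map_add' := fun x y => by ext p; by_cases hp : I p <;> simp [hp]
       map_smul' := fun c x => by ext p; by_cases hp : I p <;> simp [hp] }, fun _ _ => rfl⟩
  -- norms: `‖g‖²` is the separator residual, `‖P w‖²` the separator mass
  have hgn : ‖g‖ ^ 2 = ∑ p, (if I p then (0 : ℝ) else ‖(D *ᵥ w) p‖ ^ 2) := by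
    rw [EuclideanSpace.norm_sq_eq]
    refine Finset.sum_congr rfl fun p _ => ?_
    change ‖(H *ᵥ w) p‖ ^ 2 = _
    rw [hH_def, ← mulVec_mulVec, mulVec_diagonal, norm_mul, hχnorm, one_mul]
    split_ifs with hp
    · rw [hharm p hp, norm_zero, sq, mul_zero]
    · rfl
  have hwn : ‖P wE‖ ^ 2 = ∑ p, (if I p then (0 : ℝ) else ‖w p‖ ^ 2) :=
    norm_proj_sq hP wE
  have hgw : ‖g‖ < τ * ‖P wE‖ := by
    refine lt_of_pow_lt_pow_left₀ 2 (by positivity) ?_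
    rw [mul_pow, hgn, hwn]
    exact hres
  -- weights and the spectral core
  obtain ⟨Z, hZ⟩ : ∃ Z : ℝ, Z = ∑ i, if lam i = 0 then ‖P (b i)‖ ^ 2 else 0 := ⟨_, rfl⟩
  obtain ⟨wgt, hwgt⟩ : ∃ wgt : ι → ℝ, ∀ j, wgt j = if lam j = 0 then 1 / (τ * Z) else 1 / |lam j| :=
    ⟨_, fun j => rfl⟩
  have hZnn : 0 ≤ Z := by
    rw [hZ]
    exact Finset.sum_nonneg fun i _ => by split_ifs <;> positivity
  have hwgt_nn : ∀ j, 0 ≤ wgt j := fun j => by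
    rw [hwgt j]
    split_ifs <;> positivity
  have hwgt_mul : ∀ j, wgt j * |lam j| ≤ 1 := fun j => by
    rw [hwgt j]
    split_ifs with h0
    · rw [h0, abs_zero, mul_zero]
      exact zero_le_one
    · rw [one_div_mul_cancel (abs_ne_zero.mpr h0)]
  have hcore := pileup_core hP b lam wE g hτ hkey hg hgw wgt (fun j => by rw [hwgt j, hZ])
  -- the family: all modes below `2τ`, re-indexed by `Fin n`
  set J := {j : ι // |lam j| < 2 * τ} with hJ
  set e := Fintype.equivFin J with he
  refine ⟨Fintype.card J, fun i => ⇑(b (e.symm i).1), fun i => lam (e.symm i).1,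
    fun i => wgt (e.symm i).1, ?_, ?_, ?_, ?_⟩
  · -- orthonormality
    intro i j
    rw [sum_star_mul_eq_inner, orthonormal_iff_ite.mp b.orthonormal]
    exact if_congr (Subtype.val_inj.trans e.symm.apply_eq_iff_eq) rfl rfl
  · -- eigen-relation
    intro j
    exact heig _
  · -- level, non-negativity, normalisation of the weights
    intro j
    exact ⟨(e.symm j).2, hwgt_nn _, hwgt_mul _⟩
  · -- the pile-up, transported along the re-indexing
    have h1 : (∑ j, if |lam j| < 2 * τ then wgt j * ‖P (b j)‖ ^ 2 else 0) =
        ∑ j ∈ Finset.univ.filter (fun j => |lam j| < 2 * τ), wgt j * ‖P (b j)‖ ^ 2 :=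
      (Finset.sum_filter _ _).symm
    have h2 : ∑ j ∈ Finset.univ.filter (fun j => |lam j| < 2 * τ), wgt j * ‖P (b j)‖ ^ 2 =
        ∑ j : J, wgt j.1 * ‖P (b j.1)‖ ^ 2 :=
      Finset.sum_subtype _ (fun j => by simp) _
    have h3 : ∑ j : J, wgt j.1 * ‖P (b j.1)‖ ^ 2 =
        ∑ i : Fin (Fintype.card J), wgt (e.symm i).1 *
          ∑ p, if I p then (0 : ℝ) else ‖b (e.symm i).1 p‖ ^ 2 := by
      rw [← Equiv.sum_comp e.symm (fun j : J => wgt j.1 * ‖P (b j.1)‖ ^ 2)]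
      exact Finset.sum_congr rfl fun i _ => by rw [norm_proj_sq hP]
    rw [← h3, ← h2, ← h1]
    exact hcore

end Generic

/-! ### The stub: instantiation at the Dirichlet Wilson cell -/

open scoped Classical
open MeasureTheory Filter Literature.MathematicalPhysics.QuantumLattice
  Literature.MathematicalPhysics.QuantumFieldTheory Literature.Probability.LatticeModels

/-- **Stub 1 — `sheetPileupOfSingularSeparator` (PILE-UP LEMMA).** For the Dirichlet Wilson cell
`D_c(μ) = wilsonCell U μ 0 s` of any `SU(3)` field on any torus, any bare mass `μ` and level
`τ > 0`: a `τ`-singular separator (`HasSingularSeparator U μ s τ`) yields `n`, an orthonormal family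
`u : Fin n → (box → ℂ)` of eigenvectors of the Hermitian cell operator — `D_c(μ) u_j = ev_j · Γ_c u_j`,
real `ev_j`, `|ev_j| < 2τ` — and weights `wgt_j ≥ 0`, `wgt_j |ev_j| ≤ 1`, with sheet-weighted
pile-up `Σ_j wgt_j · f(u_j) > 1/(2τ)`, `f(u) = Σ_{p ∉ childrenInterior s} ‖u_p‖²`.
Proof: `pileup_of_chiHermitian` for `D_c(μ)` with `χ_p = (γ₅)_{α_p α_p}` (`gammaFive_eq_diagonal`:
`±1`), whose `χ`-hermiticity is entrywise `γ₅`-hermiticity of the Wilson–Dirac matrix restricted to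
the box (`CoerciveSeaNegative.conj_wilsonDirac_apply`). [folklore] -/
theorem stub_sheetPileupOfSingularSeparator :
    ∀ (N : ℕ) [NeZero N] (U : GaugeConfig 4 N (Matrix.specialUnitaryGroup (Fin 3) ℂ)) (s : Fin 4 → ℕ)
      (μ τ : ℝ), HasSingularSeparator U μ s τ → 0 < τ →
      ∃ n : ℕ, ∃ u : Fin n → ({p // wilsonBox (0 : TorusSite 4 N) s p} → ℂ), ∃ ev wgt : Fin n → ℝ, (∀ i j, ∑ p, star (u i p) * u j p = if i = j then 1 else 0) ∧ (∀ j, (wilsonCell U μ 0 s).mulVec (u j) = fun p => (ev j : ℂ) * gammaFive p.1.2.2 p.1.2.2 * u j p) ∧ (∀ j, |ev j| < 2 * τ ∧ 0 ≤ wgt j ∧ wgt j * |ev j| ≤ 1) ∧ 1 / (2 * τ) < ∑ j, wgt j * ∑ p, if childrenInterior s p then (0 : ℝ) else ‖u j p‖ ^ 2 := by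
  intro N _ U s μ τ hsing hτ
  obtain ⟨w, -, hharm, hres⟩ := hsing
  have hχ : ∀ α : Fin 4, gammaFive α α = (![1, 1, -1, -1] : Fin 4 → ℂ) α := fun α => by
    rw [gammaFive_eq_diagonal, diagonal_apply_eq]
  have hχ2 : ∀ p : {p // wilsonBox (0 : TorusSite 4 N) s p},
      gammaFive p.1.2.2 p.1.2.2 * gammaFive p.1.2.2 p.1.2.2 = 1 := fun p => by
    rw [hχ]
    exact Summit.QuantumFields.QCD.Theorems.CoerciveSeaNegative.chiSign_sq _
  have hχs : ∀ p : {p // wilsonBox (0 : TorusSite 4 N) s p},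
      star (gammaFive p.1.2.2 p.1.2.2) = gammaFive p.1.2.2 p.1.2.2 := fun p => by
    rw [hχ]
    generalize p.1.2.2 = α
    fin_cases α <;> simp
  have hD : ∀ i j : {p // wilsonBox (0 : TorusSite 4 N) s p},
      star (wilsonCell U μ 0 s j i) =
        gammaFive i.1.2.2 i.1.2.2 * wilsonCell U μ 0 s i j * gammaFive j.1.2.2 j.1.2.2 := by
    intro i j
    rw [hχ, hχ]
    have h := Summit.QuantumFields.QCD.Theorems.CoerciveSeaNegative.conj_wilsonDirac_apply
      (fundamentalRep (Fin 3)) fundamentalRep_mem_unitaryGroup U μ i.1 j.1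
    rw [starRingEnd_apply] at h
    exact h
  exact pileup_of_chiHermitian (wilsonCell U μ 0 s) (fun p => gammaFive p.1.2.2 p.1.2.2) hχ2 hχs hD
    (childrenInterior s) w hharm hres hτ

end Summit.QuantumFields.QCD.Cruxes.CoerciveSea.ChiralityCollapsesPseudospectrum

end
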